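/-
Copyright (c) 2026 the pub-hodgecm-mathlib formalisation cell (harness21).  Prover seat hodgecm-mathlib-LH3-p04 (g3): LH3 «Transf» road,
organ-grade head (SB-TRANSF), binder-free (dealer LH3-plan (g3) RULINGS #2 (SB) 2026-09-02T07:16Z).
-/
import Literature.NumberTheory.Rogawski1990.ArchTransfFamilySmoothInRegS      -- ★ p850233 LH3-p04 (g3): (SB-TRANSF) modulo `hwall` (corners ★ p850123, tame points ★ p850171, jet bounds ★ p850197)
import Literature.NumberTheory.Rogawski1990.ArchTransfFamilySmoothAcross       -- ★ F0P3a-p09 (g5) (GLUE-X-dress) FILE B3: `contDiffOn_transfFam_nhds_wall` (the κ-pair gluing, in `hwall`'s shape)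
import HarnessLib

/-!
# (SB-TRANSF) — Bouaziz's (I₁)+(I₂) for the `Δ″`-transfer family: `ArchBzSmoothBounded (transfFam L α μ F)` for every `F` in Harish-Chandra's space, binder-free
# (Bouaziz 1994 §3.2 (I₁)–(I₂) p. 579, §6.2 p. 591, Rem. 2 p. 594; Shelstad 1979 §4, Thm. 4.7 p. 31; Rogawski 1990 §4.3 (4.3.1) p. 43, Prop. 4.9.1 (a) p. 55)

Topic `NumberTheory/Rogawski1990`; namespace `Literature.NumberTheory.Rogawski1990`.  THEOREMS ONLY (no `def`, no instance, no notation, no axiom, no named fact,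
no `sorry`); kernel lane `--supports stmt-HodgeConjecture-24833`.  Cell `pub/hodgecm-mathlib`, crux H413 (`stmt-HodgeConjecture-24833`), F0∕P3c line LH3 (closer stub
`stub_N9`, DIRECT ROAD «Transf», organ O-L2 `stub_N9transf`).  **The organ-grade head (SB-TRANSF)** (dealer LH3-plan (g3) RULINGS #2 (SB) 2026-09-02T07:16Z; one writer
per head: LH3-p04 (g3)): ★ `archBzSmoothBounded_transfFam_of_hc_of_wall` (p850233) with its one explicit input `hwall` DISCHARGED by F0P3a-p09 (g5)'s ★ (GLUE-X-dress) head
`contDiffOn_transfFam_nhds_wall` ∕ `contDiffOn_transfFam_nhds_of_circleExp_eq` (the κ-pair cancellation `'F + 'F∘s` across a noncompact `G′`-wall at an `H`-regular semiregular point, all `2π`-branches).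

RESULT.  For the house frame (`α_i ≠ 0`, real at every complex place), the `μ`-guard `μ|_{𝔸_{L⁺}^×} = ω`, and EVERY family `F` in Harish-Chandra's space
★ `ArchHCSpaceG (slotSign L α) jc′ F`: **`ArchBzSmoothBounded (transfFam L α μ F)`** — on every chart `S` the transfer `transfFam … S` is `C^∞` on Bouaziz's `T_{in-reg} = InRegS S`
(across the `G`-walls `e^{ic_{w1}} = e^{ic_{w0}}`, `e^{ic_{w1}} = e^{ic_{w2}}`, the real walls `x_w = 0`, and all their corners) and every jet is bounded on `K ∩ InRegS S` for every
compact `K` (no blow-up at the removed `H`-imaginary walls).  This is the (I₁)+(I₂) conjunct `hSB` of the L2 assembler ★ `archBouazizSpaceH_transfFam_of_hc (hF) (hSB) (hJ)`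
(LH3-p02 (g2), p850089) and of (I₃-TRANSF) ED. 1 (LH7-p02 (g2)); (M2) `hcont` (★ p850030) is its `.continuousOn`.  What remains of organ `stub_N9transf` after this file: the jump
conjunct `hJ : ArchBzJump jcH (transfFam L α μ F)` ((I₃-TRANSF), LH7-p02 (g2)).

HONEST LABEL: HC_CM is proved only modulo the 7 printed citations (2 remaining: hLiu418 = `stmt-HodgeConjecture-24832`, h413 = `stmt-HodgeConjecture-24833`) until rung 0
closes; this file pays the (SB) conjunct of organ O-L2 in-house (count-neutral until the organ's other conjunct lands).

## References
* [Bouaziz1994IntegralesOrbitales] A. Bouaziz, *Intégrales orbitales sur les groupes de Lie réductifs*, Ann. Sci. ÉNS 27 (1994), §3.2 (I₁)–(I₂) p. 579, §6.2 p. 591, Rem. 2 p. 594.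
* [Shelstad1979] D. Shelstad, *Characters and inner forms of a quasi-split group over ℝ*, Compositio Math. 39 (1979), §4 pp. 22–23, Thm. 4.7 p. 31.
* [Rogawski1990] J. D. Rogawski, *Automorphic Representations of Unitary Groups in Three Variables*, Ann. of Math. Stud. 123 (1990), §4.3 (4.3.1) p. 43, Prop. 4.9.1 (a) p. 55,
  §8.2 p. 119.
* [Varadarajan1977] V. S. Varadarajan, *Harmonic Analysis on Real Reductive Groups*, LNM 576 (1977), Part I §1.12.
-/

set_option autoImplicit false

noncomputable section

open NumberField NumberField.InfinitePlace Complex Equiv Finset Filter Topology Set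
open scoped MatrixGroups ComplexConjugate Classical ContDiff
open Literature.NumberTheory.Automorphic Literature.NumberTheory.Automorphic.UnitaryGroup Literature.NumberTheory.Automorphic.ArchCartan
open Literature.NumberTheory.GaloisRepresentations

namespace Literature.NumberTheory.Rogawski1990

section Head

variable (L : Type) [Field L] [NumberField L] [IsCMField L] (α : Fin 3 → L) (μ : HeckeCharacter L)

/-- **(SB-TRANSF) — `ArchBzSmoothBounded (transfFam L α μ F)` FOR EVERY `F ∈ ArchHCSpaceG (slotSign L α) jc′`** (house frame, `μ`-guard): Bouaziz's (I₁)+(I₂) for the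
`Δ″`-weighted transfer family — `C^∞` on every `InRegS S`, jets bounded on `K ∩ InRegS S`.  ★ p850233's head with `hwall` discharged by ★ `contDiffOn_transfFam_nhds_wall`
(F0P3a-p09 (g5), p850280). [cite: Bouaziz1994IntegralesOrbitales, §3.2 (I₁)–(I₂) p. 579; §6.2 p. 591; Rem. 2 p. 594] [cite: Shelstad1979, Thm. 4.7 (p. 31)]
[cite: Rogawski1990, §4.3 (4.3.1) p. 43; Prop. 4.9.1 (a) p. 55] -/
theorem archBzSmoothBounded_transfFam_of_hc (hα : ∀ i, α i ≠ 0) (hreal : ∀ (w : {w : InfinitePlace L // IsComplex w}) (i : Fin 3), (w.1.embedding (α i)).im = 0)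
    (hμω : ∀ x : ideleGroup ↥(maximalRealSubfield L), μ (AdeleRing.ideleBaseChange (↥(maximalRealSubfield L)) L x) = quadraticHeckeCharCM L x)
    {jc' : Finset {w : InfinitePlace L // IsComplex w} → {w : InfinitePlace L // IsComplex w} → Fin 3 → Fin 3 → ℂ}
    {F : Finset {w : InfinitePlace L // IsComplex w} → ({w : InfinitePlace L // IsComplex w} → Fin 3 → ℝ) → ℂ} (hF : ArchHCSpaceG (slotSign L α) jc' F) :
    ArchBzSmoothBounded (transfFam L α μ F) :=
  archBzSmoothBounded_transfFam_of_hc_of_wall L α μ hμω hF (contDiffOn_transfFam_nhds_wall L α μ hα hreal hμω hF)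

/-- **(c1) binder-free: `transfFam … S` is `C^∞` on `InRegS S`, every chart `S`.** [cite: Bouaziz1994IntegralesOrbitales, §3.2 (I₂) p. 579] [cite: Shelstad1979, Thm. 4.7 (p. 31)] -/
theorem contDiffOn_transfFam_inRegS (hα : ∀ i, α i ≠ 0) (hreal : ∀ (w : {w : InfinitePlace L // IsComplex w}) (i : Fin 3), (w.1.embedding (α i)).im = 0)
    (hμω : ∀ x : ideleGroup ↥(maximalRealSubfield L), μ (AdeleRing.ideleBaseChange (↥(maximalRealSubfield L)) L x) = quadraticHeckeCharCM L x)
    {jc' : Finset {w : InfinitePlace L // IsComplex w} → {w : InfinitePlace L // IsComplex w} → Fin 3 → Fin 3 → ℂ}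
    {F : Finset {w : InfinitePlace L // IsComplex w} → ({w : InfinitePlace L // IsComplex w} → Fin 3 → ℝ) → ℂ} (hF : ArchHCSpaceG (slotSign L α) jc' F)
    (S : Finset {w : InfinitePlace L // IsComplex w}) : ContDiffOn ℝ ∞ (transfFam L α μ F S) (InRegS S) :=
  (archBzSmoothBounded_transfFam_of_hc L α μ hα hreal hμω hF S).1

/-- **(c2) binder-free: the (I₁) bound of `transfFam … S` on `K ∩ InRegS S`, every chart `S`, every compact `K`, every order.** [cite: Bouaziz1994IntegralesOrbitales, §3.2 (I₁) p. 579]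
[cite: Shelstad1979, §4 (I) p. 23] -/
theorem bddAbove_norm_iteratedFDeriv_transfFam (hα : ∀ i, α i ≠ 0) (hreal : ∀ (w : {w : InfinitePlace L // IsComplex w}) (i : Fin 3), (w.1.embedding (α i)).im = 0)
    (hμω : ∀ x : ideleGroup ↥(maximalRealSubfield L), μ (AdeleRing.ideleBaseChange (↥(maximalRealSubfield L)) L x) = quadraticHeckeCharCM L x)
    {jc' : Finset {w : InfinitePlace L // IsComplex w} → {w : InfinitePlace L // IsComplex w} → Fin 3 → Fin 3 → ℂ}
    {F : Finset {w : InfinitePlace L // IsComplex w} → ({w : InfinitePlace L // IsComplex w} → Fin 3 → ℝ) → ℂ} (hF : ArchHCSpaceG (slotSign L α) jc' F)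
    (S : Finset {w : InfinitePlace L // IsComplex w}) (n : ℕ) {K : Set ({w : InfinitePlace L // IsComplex w} → Fin 3 → ℝ)} (hK : IsCompact K) :
    BddAbove ((fun c => ‖iteratedFDeriv ℝ n (transfFam L α μ F S) c‖) '' (K ∩ InRegS S)) :=
  (archBzSmoothBounded_transfFam_of_hc L α μ hα hreal hμω hF S).2 n K hK

/-- **(M2) binder-free — the `hcont` input of ★ `archBzWeyl_transfFam_of_hcWeyl` (p850030), in its binder shape**: every `transfFam … S` of an admissible chart is continuous on
`InRegS S` (in fact on every chart). [cite: Bouaziz1994IntegralesOrbitales, §3.2 (I₁) p. 579] [cite: Rogawski1990, Prop. 4.9.1 (a) p. 55] -/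
theorem continuousOn_transfFam_inRegS (hα : ∀ i, α i ≠ 0) (hreal : ∀ (w : {w : InfinitePlace L // IsComplex w}) (i : Fin 3), (w.1.embedding (α i)).im = 0)
    (hμω : ∀ x : ideleGroup ↥(maximalRealSubfield L), μ (AdeleRing.ideleBaseChange (↥(maximalRealSubfield L)) L x) = quadraticHeckeCharCM L x)
    {jc' : Finset {w : InfinitePlace L // IsComplex w} → {w : InfinitePlace L // IsComplex w} → Fin 3 → Fin 3 → ℂ}
    {F : Finset {w : InfinitePlace L // IsComplex w} → ({w : InfinitePlace L // IsComplex w} → Fin 3 → ℝ) → ℂ} (hF : ArchHCSpaceG (slotSign L α) jc' F) :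
    ∀ S : Finset {w : InfinitePlace L // IsComplex w}, (∀ w, w ∈ S → w ∈ splitChartPlaces L α) → ContinuousOn (transfFam L α μ F S) (InRegS S) :=
  fun S _ => (contDiffOn_transfFam_inRegS L α μ hα hreal hμω hF S).continuousOn

/-- **(W) of the transfer, binder-free** (★ p850030 `archBzWeyl_transfFam_of_hcWeyl` with its `hcont` discharged): `ArchBzWeyl (transfFam L α μ F)` for `F ∈ ArchHCSpaceG`.
[cite: Shelstad1979, §4 (II) p. 23] [cite: Bouaziz1994IntegralesOrbitales, §6.2 p. 591] -/
theorem archBzWeyl_transfFam_of_hc (hα : ∀ i, α i ≠ 0) (hreal : ∀ (w : {w : InfinitePlace L // IsComplex w}) (i : Fin 3), (w.1.embedding (α i)).im = 0)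
    (hμω : ∀ x : ideleGroup ↥(maximalRealSubfield L), μ (AdeleRing.ideleBaseChange (↥(maximalRealSubfield L)) L x) = quadraticHeckeCharCM L x)
    {jc' : Finset {w : InfinitePlace L // IsComplex w} → {w : InfinitePlace L // IsComplex w} → Fin 3 → Fin 3 → ℂ}
    {F : Finset {w : InfinitePlace L // IsComplex w} → ({w : InfinitePlace L // IsComplex w} → Fin 3 → ℝ) → ℂ} (hF : ArchHCSpaceG (slotSign L α) jc' F) :
    ArchBzWeyl (transfFam L α μ F) :=
  archBzWeyl_transfFam_of_hcWeyl L α μ F hF.2.1 (continuousOn_transfFam_inRegS L α μ hα hreal hμω hF)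

end Head

end Literature.NumberTheory.Rogawski1990

end
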